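import Mathlib
import Literature.NumberTheory.Sieve.Maynard2016SingSeriesPos
import HarnessLib

/-!
# Maynard 2016: positivity of the Lemma-6 main term `M_{m,q}`

Topic `Literature/NumberTheory/Sieve`. J. Maynard, *Large gaps between primes*, Ann. of Math. (2)
183 (2016), 915–933 = arXiv:1408.5110, Lemma 6 and display (6.22): the normalisation
`M_{m,q} = U 𝔖_{m,q} I_k^{(1)}(F) I_k^{(2)}(G) / (m (log x)^k (log y)^k)` (tree: `normMain`) is
positive for even `m ≥ 1`, all `q`, and all large `x`, once `I^{(1)}, I^{(2)} > 0` (hypotheses of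
Lemmas 6 and 7 as typed): `U > 0` (`U_pos`), `𝔖_{m,q} > 0` (`singSeriesMQ_pos`), `log x, log y > 0`.
This is what the division in (6.22) (tree: `Lemma7Pos`, `Lemma7Tuple`) silently uses.

PROVED here (no named facts): `normMain_pos` (pointwise) and `eventually_normMain_pos`.

## References

* J. Maynard, *Large gaps between primes*, Ann. of Math. (2) 183 (2016), 915–933; arXiv:1408.5110,
  Lemma 6 and display (6.22). [Maynard2016LargeGaps]
-/

open Filter Finset
open scoped Topology

namespace Literature.NumberTheory.Sieve

namespace Maynard2016

/-- `M_{m,q} > 0` from `U > 0`, `𝔖_{m,q} > 0`, `I^{(1)}, I^{(2)} > 0`, `m ≥ 1`, `log x, log y > 0`. [cite: Maynard2016LargeGaps, Lemma 6] -/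
theorem normMain_pos {k J : ℕ} {cj : Fin J → ℝ} {Fd : Fin k → Fin J → ℝ → ℝ} {G : ℝ → ℝ}
    {C_U ε : ℝ} {x m q : ℕ} (hU : 0 < U C_U ε x) (hS : 0 < singSeriesMQ k ε x m q)
    (hI1 : 0 < I1 cj Fd) (hI2 : 0 < I2 k G) (hm : 1 ≤ m) (hL : 0 < Real.log x)
    (hly : 0 < Real.log (y ε x)) : 0 < normMain cj Fd G C_U ε x m q := by
  unfold normMain
  have hm0 : (0 : ℝ) < m := by exact_mod_cast hm
  positivity

/-- **Eventually `M_{m,q} > 0`:** for `k ≥ 1`, `C_U > 0`, `ε ≤ 1/2` and `I^{(1)}, I^{(2)} > 0`, for all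
large `x`, every even `m ≥ 1` and every `q`. [cite: Maynard2016LargeGaps, Lemma 6 and display (6.22)] -/
theorem eventually_normMain_pos {k J : ℕ} (hk : 0 < k) {cj : Fin J → ℝ}
    {Fd : Fin k → Fin J → ℝ → ℝ} {G : ℝ → ℝ} {C_U ε : ℝ} (hCU : 0 < C_U) (hε : ε ≤ 1 / 2)
    (hI1 : 0 < I1 cj Fd) (hI2 : 0 < I2 k G) :
    ∀ᶠ x : ℕ in atTop, ∀ m : ℕ, 1 ≤ m → Even m → ∀ q : ℕ,
      0 < normMain cj Fd G C_U ε x m q := by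
  filter_upwards [eventually_wTrick hε, eventually_iteratedLogs, eventually_gt_atTop 0,
    eventually_singSeriesMQ_pos hk ε] with x hw hlogs hx0 hS m hm hmev q
  obtain ⟨-, hly, -⟩ := hw
  obtain ⟨hL4, hL₂2, -⟩ := hlogs
  exact normMain_pos (U_pos hCU hx0 hly (by linarith)) (hS m hmev q) hI1 hI2 hm (by linarith) hly

end Maynard2016

end Literature.NumberTheory.Sieve
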